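/-
Copyright (c) 2026 the pub-hodgecm-mathlib formalisation cell (harness21).  Prover seat hodgecm-mathlib-LH4-p14 (g8) (L1 valve hand; (P-dec) writer ∕ K1b in-line desk per the
K1b∕ρ desk's handoff 2026-09-05T00:32Z), Track B «K2-LIT» ∕ hLiu418 #184♮, socket #41 KIND 1, package (K1b-♮), letter (P-dec):
THE (P-dec) HEAD — ★ p863630's ∀-frame decay letters `hWdec1 ∕ hWdec0` from the decay in ONE frame.  THEOREMS ONLY.
-/
import Summits.HodgeConjecture.HodgeConjecture.Theorems.K2LiuKindOneLineFrameChange      -- ★ (dec-0′) `exists_whittakerDelta_line_eq_smul_of_frames(_inl)` (⊇ ★ p863703, ★ pin)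
import Summits.HodgeConjecture.HodgeConjecture.Theorems.K2LiuKindOneLineEulerTransfer    -- ★ p863428 (dec-1): `half_re_le_re_of_dist_lt`
import Summits.HodgeConjecture.HodgeConjecture.Theorems.K2LiuRankOneLeviConjIndex      -- ★ `exists_levi_conj_index` (a transported index at the fixed frame)
import HarnessLib

/-!
# Crux `HLiu418`, socket #41, KIND 1 — (P-dec) HEAD `K2LiuKindOneLineDecay`: THE ∀-FRAME DECAY LETTERS OF ★ p863630 FROM THE DECAY IN ONE FRAME

Cell `hodgecm-mathlib`, crux item hLiu418 = `stmt-HodgeConjecture-24832` (helper lane `--supports … --as helper`, count-neutral), route of record `HCCMUnconditional`;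
squad K2 ∕ K2Liu, road `K2_Liu`, socket #41, KIND 1, package (K1b-♮).  OF-RECORD ★ p863630 `exists_kindOne_lineTerm_of_record` leaves BY VALUE `hlatU` ((P-supp-lat)) and
`Nb hWdec1 hWdec0` ((P-dec)): the `D`-polynomial decay of the rank-one line Whittaker value in `W`-currency FOR EVERY FRAME `(eA eB dA dB, Λ, μ, nB, γ)` of each enumeration
and every transported index `S'`.  THIS FILE is the (P-dec) HEAD of record: by ★ (dec-0′) `K2LiuKindOneLineFrameChange` two frames of the same enumeration give
PROPORTIONAL line Whittaker values (`W(F) = c • W(F₀)`, ONE `c > 0` per pair of frames, uniform in the index, the transported indices, `s` and the point), and by ★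
`exists_levi_conj_index` every rank-one index has a transported index at the fixed frame; hence the decay in ONE frame `F₀` of the payer's choice — the letter `hdecF₀`, i.e.
`hWdec1`'s (resp. `hWdec0`'s) inner block AT `F₀` — yields `hWdec1` AND `hWdec0` for every frame (constants `× c`, radius shrunk to `min r (re z ∕ 2)` so that `0 < re s`; the
two additive-Haar σ-algebras on `𝔸_{L⁺}` are both Borel, hence equal; the other enumeration's letter is vacuous since `(1 : Fin 2) ≠ 0`).
* **`wdec_of_oneFrame`** — `e (1,0) = 1`: socket prefix + ONE `B`-line frame `F₀` + `Nb` + `hdecF₀` ⊢ `hWdec1 ∧ hWdec0` (★ p863630's binder TYPES, token for token).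
* **`wdec_of_oneFrame_inl`** — `e (1,0) = 0`: the same from ONE `A`-line frame.
RESIDUE after this file (the (P-dec) payer letter, by value): `hdecF₀` = the ONE-FRAME ASSEMBLY `K2LiuKindOneLineDecayOneFrame` = ★ (dec-1) p863428 ∘ (dec-3) [★ p863568 (ρ4-𝔸)
exponential face, ★ p863519 (dec-3b-i), ★ p863374 (ρ6a), (B-i)(B-iii)(ρ6b), (dec-3b-ii) LH4-p09 (g10)] ∘ (dec-2) [the fine letter of the corner-translate family = the KW-payer
residue at `n := 1`, BY VALUE] at a frame with the normalised row section `γ₀` of ★ p863259.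
HONEST LABEL.  Count-neutral helper, hypothesis-first in `hdecF₀`; closes no socket: `HC_CM` is proved only modulo the 7 printed citations (2 remaining named inputs:
hLiu418 = `stmt-HodgeConjecture-24832`, h413 = `stmt-HodgeConjecture-24833`) until rung 0 closes.

## References
* [KudlaRallis1994] S. Kudla, S. Rallis, Ann. of Math. 140 (1994): §2 (2.10)–(2.12).
* [MoeglinWaldspurger1995] C. Mœglin, J.-L. Waldspurger, *Spectral decomposition and Eisenstein series* (1995): II.1.7, IV.1.9.
* [Shimura1997] G. Shimura, CBMS 93 (1997): §18.4 Prop. 18.14.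
-/

set_option autoImplicit false
-- the mandated namespace repeats the single-problem summit's segment (`HodgeConjecture.HodgeConjecture`)
set_option linter.dupNamespace false

noncomputable section

open scoped Matrix ENNReal NNReal Topology ComplexConjugate
-- `Classical` is needed to see the Mathlib normed-ring instances on `mixedSpace L` (as in the TOP's `hτ`)
open scoped Classical
open NumberField IsDedekindDomain MeasureTheory MeasureTheory.Measure Filter Set Function
open Literature.NumberTheory.Automorphic Literature.NumberTheory.Automorphic.UnitaryGroup Literature.NumberTheory.GaloisRepresentations
open Literature.NumberTheory.GelbartRogawski1991 Literature.NumberTheory.GelbartRogawski1991.GRConstruction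
open Literature.NumberTheory.GelbartRogawski1991.AdaptedBlocks
open Literature.NumberTheory.K2Lit.SiegelDoubled Literature.MeasureTheory.Group
open Literature.NumberTheory.Automorphic.IdeleClassGroup
open UnitaryDualPair

namespace Summit.HodgeConjecture.HodgeConjecture.Cruxes.HLiu418.K2LiuKindOneLineDecay

open K2LiuSiegelUnipotentFourierDefs K2LiuSiegelUnipotentCharacters K2LiuUnipotentCoveringWeight K2LiuSiegelFourierCoeffDelta
open K2LiuSiegelRationalLeviDecomposition K2LiuSiegelMiddleCellSortedPattern K2LiuSiegelMiddleCellLeviCriterion K2LiuSiegelBruhatMiddleCellDelta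
open K2LiuKindOneLineFrameChange (exists_whittakerDelta_line_eq_smul_of_frames exists_whittakerDelta_line_eq_smul_of_frames_inl)
open K2LiuKindOneLineEulerTransfer (half_re_le_re_of_dist_lt)
open K2LiuRankOneLeviConjIndex (exists_levi_conj_index)

/-- `(1 : Fin 2) ≠ 0`: the two enumerations exclude each other. [folklore] -/
theorem enum_absurd {e : Fin 2 × Fin 1 ≃ Fin 2} (h1 : e (1, 0) = 1) (h0 : e (1, 0) = 0) : False :=
  absurd (h1.symm.trans h0) (by decide)

/-- the norm of a positive real multiple. [folklore] -/
theorem norm_real_smul_of_pos {c : ℝ} (hc : 0 < c) (z : ℂ) : ‖c • z‖ = c * ‖z‖ := by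
  rw [norm_smul, Real.norm_of_nonneg hc.le]

/-- **THE (P-dec) HEAD** (corner enumeration `e (1,0) = 1`).  Socket prefix of #41 at `n = 2` VERBATIM (★ p863630's); ONE `B`-line frame
`F₀ = (eA₀ eB₀ dA₀ dB₀, Λ₀, μ₀, nB₀, γ₀)` BY VALUE (★ p863230's frame bytes); `Nb`; and the ONE-FRAME decay letter `hdecF₀` = `hWdec1`'s inner block AT `F₀`
(`∀ z, 0 < re z → ∃ C a a₂ c a' r, … ∀ S u w … S' hψ D … s, dist s z < r → ∀ h, ‖W(F₀; S')(s,h)‖ ≤ C·H(h)^a·D^{a₂}·(exp(−c·H(h)^{−a'}·τS)·(1+τS)^Nb)`).  THEN ★ p863630's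
`hWdec1` AND `hWdec0` (their binder types token for token).  [cite: KudlaRallis1994, §2 (2.10)–(2.12)] [cite: MoeglinWaldspurger1995, II.1.7, IV.1.9]
[cite: Shimura1997, §18.4 Prop. 18.14] -/
theorem wdec_of_oneFrame
    (L : Type) [Field L] [NumberField L] [IsCMField L] (e : Fin 2 × Fin 1 ≃ Fin 2)
    (dV : Fin 2 → L) (hdV : ∀ i, IsCMField.complexConj L (dV i) = dV i) (hdV0 : ∀ i, dV i ≠ 0)
    (dW : Fin 1 → L) (hdW : ∀ i, IsCMField.complexConj L (dW i) = dW i) (hdW0 : ∀ i, dW i ≠ 0)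
    (lam : IdeleClassGroup L →ₜ* Circle) (hlam : IsConjugateSymplectic L lam) (hw : HasWeight L lam 1)
    (𝒦 : IwasawaDatum L e dV hdV dW hdW) (h𝒦 : 𝒦.IsStd) (f : ℂ → HA L e dV hdV dW hdW → ℂ)
    (hstd : IsStandardSectionFamily 𝒦 (toHeckeCharacter L lam⁻¹) f) (hcont : ∀ s, Continuous (f s))
    [MeasurableSpace (unipDelta L e dV hdV dW hdW)] [BorelSpace (unipDelta L e dV hdV dW hdW)]
    (νN : Measure (unipDelta L e dV hdV dW hdW)) [νN.IsHaarMeasure]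
    (β : unipDelta L e dV hdV dW hdW → ℝ≥0∞) (hβ : IsCoveringWeight (unipDeltaRat L e dV hdV dW hdW) β)
    (hβ0 : ∫⁻ u, β u ∂νN ≠ 0) (hβtop : ∫⁻ u, β u ∂νN ≠ ∞)
    {K : Set (unipDelta L e dV hdV dW hdW)} (hK : IsCompact K) (hβK : ∀ u, β u ≤ K.indicator 1 u)
    (wq : unipDeltaRat L e dV hdV dW hdW → ratH L e dV hdV dW hdW)
    (hwq : ∀ ν, ((wq ν : ratH L e dV hdV dW hdW) : HA L e dV hdV dW hdW) = weylDelta L e dV hdV dW hdW * ((ν : unipDelta L e dV hdV dW hdW) : HA L e dV hdV dW hdW))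
    (he : e (1, 0) = 1)
    -- ONE frame `F₀` BY VALUE (★ p863230's frame bytes)
    -- the see-saw datum `V = A ⊕ B` BY VALUE (the writer takes `eA₀ = eB₀` the unique equivalence, `dA₀ _ := dV 0`, `dB₀ _ := dV 1`, `borel` instances)
    {n₁₀ n₂₀ : ℕ} (eA₀ : Fin 1 × Fin 1 ≃ Fin n₁₀) (eB₀ : Fin 1 × Fin 1 ≃ Fin n₂₀)
    (dA₀ : Fin 1 → L) (hdA₀ : ∀ i, IsCMField.complexConj L (dA₀ i) = dA₀ i)
    (dB₀ : Fin 1 → L) (hdB₀ : ∀ i, IsCMField.complexConj L (dB₀ i) = dB₀ i) (hdB0₀ : ∀ i, dB₀ i ≠ 0)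
    (hVA₀ : ∀ i, dV (Fin.castAdd 1 i) = dA₀ i) (hVB₀ : ∀ j, dV (Fin.natAdd 1 j) = dB₀ j)
    [MeasurableSpace (unipDelta L eB₀ dB₀ hdB₀ dW hdW)] [BorelSpace (unipDelta L eB₀ dB₀ hdB₀ dW hdW)]
    -- the Levi chart BY VALUE (★ `exists_leviHom`)
    (Λ₀ : GL (Fin 2) (AdeleRing (𝓞 L) L) →* HA L e dV hdV dW hdW)
    (hΛ₀ : ∀ g : GL (Fin 2) (AdeleRing (𝓞 L) L), blk L e dV hdV dW hdW (Λ₀ g) =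
      cayR (AdeleRing (𝓞 L) L) (Fin 2) * Matrix.fromBlocks (g : Matrix (Fin 2) (Fin 2) (AdeleRing (𝓞 L) L)) 0 0
        (((gramR L e dV hdV dW hdW).map ((algebraMap L (AdeleRing (𝓞 L) L)).comp (algebraMap (Fp L) L)))⁻¹ *
          (((g⁻¹ : GL (Fin 2) (AdeleRing (𝓞 L) L)) : Matrix (Fin 2) (Fin 2) (AdeleRing (𝓞 L) L)).map
            (conjAdele (Fp L) L (IsCMField.complexConj L)))ᵀ *
          (gramR L e dV hdV dW hdW).map ((algebraMap L (AdeleRing (𝓞 L) L)).comp (algebraMap (Fp L) L))) *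
        cayRinv (AdeleRing (𝓞 L) L) (Fin 2))
    -- the additive Haar measure on `𝔸_{L⁺}` and the line chart of `H(B)` BY VALUE (★ p862662 `exists_lineChart`)
    [mA₀ : MeasurableSpace (AdeleRing (𝓞 (Fp L)) (Fp L))] [bA₀ : BorelSpace (AdeleRing (𝓞 (Fp L)) (Fp L))]
    (μ₀ : Measure (AdeleRing (𝓞 (Fp L)) (Fp L))) [μ₀.IsAddHaarMeasure]
    (nB₀ : AdeleRing (𝓞 (Fp L)) (Fp L) → unipDelta L eB₀ dB₀ hdB₀ dW hdW) (hnBc₀ : Continuous nB₀) (hnBadd₀ : ∀ s t, nB₀ (s + t) = nB₀ s * nB₀ t)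
    (hnB₀ : ∀ t, (blk L eB₀ dB₀ hdB₀ dW hdW (nB₀ t : HA L eB₀ dB₀ hdB₀ dW hdW)).toBlocks₁₂ =
      Matrix.of fun _ _ => AdeleRing.baseChange (Fp L) L t * algebraMap L (AdeleRing (𝓞 L) L) (imagUnit L))
    -- the row section BY VALUE (★ `exists_rowSection`)
    (γ₀ : Projectivization L (Fin 2 → L) → GL (Fin 2) L)
    (hγ₀ : ∀ p, Projectivization.mk L ((γ₀ p : Matrix (Fin 2) (Fin 2) L) 1) (row_ne_zero (γ₀ p) 1) = p)
    -- the decay exponent and the ONE-FRAME decay letter (= ★ p863630's inner block AT `F₀`)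
    (Nb : ℕ)
    (hdecF₀ : ∀ z : ℂ, 0 < z.re → ∃ C a a₂ c a' r : ℝ, 0 ≤ C ∧ 0 ≤ a ∧ 0 ≤ a₂ ∧ 0 < c ∧ 0 ≤ a' ∧ 0 < r ∧
        ∀ (S : skewMatrices ((IsCMField.complexConj L : L ≃ₐ[Fp L] L) : L →+* L) ((gramR L e dV hdV dW hdW).map (algebraMap (Fp L) L))) (u w : Fin 2 → L),
          (S : Matrix (Fin 2) (Fin 2) L) = Matrix.vecMulVec u w → u ≠ 0 → ∀ (hw : w ≠ 0) (S' : Matrix (Fin 2) (Fin 2) L),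
          (∀ v : HA L e dV hdV dW hdW, v ∈ unipDelta L e dV hdV dW hdW →
            unipDeltaChar L e dV hdV dW hdW (S : Matrix (Fin 2) (Fin 2) L) ((Λ₀ (Matrix.GeneralLinearGroup.map (algebraMap L (AdeleRing (𝓞 L) L)) (γ₀ (Projectivization.mk L w hw))))⁻¹ * v * Λ₀ (Matrix.GeneralLinearGroup.map (algebraMap L (AdeleRing (𝓞 L) L)) (γ₀ (Projectivization.mk L w hw)))) =
              unipDeltaChar L e dV hdV dW hdW S' v) →
          ∀ D : ℕ, 1 ≤ D → (∀ i j, IsIntegral ℤ ((D : L) * (S : Matrix (Fin 2) (Fin 2) L) i j)) →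
          ∀ s : ℂ, dist s z < r → ∀ h : HA L e dV hdV dW hdW,
            ‖whittakerDelta L eB₀ dB₀ hdB₀ dW hdW (Measure.map nB₀ μ₀)
                ((Matrix.reindex (idxSplit e eA₀ eB₀) (idxSplit e eA₀ eB₀) S').toBlocks₂₂)
                (fun y => f s (blkD L e eA₀ eB₀ dA₀ hdA₀ dB₀ hdB₀ dV hdV hVA₀ hVB₀ dW hdW (1, y) * (Λ₀ (Matrix.GeneralLinearGroup.map (algebraMap L (AdeleRing (𝓞 L) L)) (γ₀ (Projectivization.mk L w hw))) * h))) 1‖ ≤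
              C * adelicHeightGL (2 + 2) L (h : GL (Fin (2 + 2)) (AdeleRing (𝓞 L) L)) ^ a * (D : ℝ) ^ a₂ *
                (Real.exp (-(c * adelicHeightGL (2 + 2) L (h : GL (Fin (2 + 2)) (AdeleRing (𝓞 L) L)) ^ (-a') * ‖(fun i j => NumberField.mixedEmbedding L ((S : Matrix (Fin 2) (Fin 2) L) i j))‖)) * (1 + ‖(fun i j => NumberField.mixedEmbedding L ((S : Matrix (Fin 2) (Fin 2) L) i j))‖) ^ Nb)) :
    (e (1, 0) = 1 → ∀ {n₁ n₂ : ℕ} (eA : Fin 1 × Fin 1 ≃ Fin n₁) (eB : Fin 1 × Fin 1 ≃ Fin n₂)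
      (dA : Fin 1 → L) (hdA : ∀ i, IsCMField.complexConj L (dA i) = dA i)
      (dB : Fin 1 → L) (hdB : ∀ i, IsCMField.complexConj L (dB i) = dB i)
      (hVA : ∀ i, dV (Fin.castAdd 1 i) = dA i) (hVB : ∀ j, dV (Fin.natAdd 1 j) = dB j)
      [MeasurableSpace (unipDelta L eB dB hdB dW hdW)] [BorelSpace (unipDelta L eB dB hdB dW hdW)]
      (Λ : GL (Fin 2) (AdeleRing (𝓞 L) L) →* HA L e dV hdV dW hdW)
      (hΛ : ∀ g : GL (Fin 2) (AdeleRing (𝓞 L) L), blk L e dV hdV dW hdW (Λ g) =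
        cayR (AdeleRing (𝓞 L) L) (Fin 2) * Matrix.fromBlocks (g : Matrix (Fin 2) (Fin 2) (AdeleRing (𝓞 L) L)) 0 0
          (((gramR L e dV hdV dW hdW).map ((algebraMap L (AdeleRing (𝓞 L) L)).comp (algebraMap (Fp L) L)))⁻¹ *
            (((g⁻¹ : GL (Fin 2) (AdeleRing (𝓞 L) L)) : Matrix (Fin 2) (Fin 2) (AdeleRing (𝓞 L) L)).map
              (conjAdele (Fp L) L (IsCMField.complexConj L)))ᵀ *
            (gramR L e dV hdV dW hdW).map ((algebraMap L (AdeleRing (𝓞 L) L)).comp (algebraMap (Fp L) L))) *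
          cayRinv (AdeleRing (𝓞 L) L) (Fin 2))
      [MeasurableSpace (AdeleRing (𝓞 (Fp L)) (Fp L))] [BorelSpace (AdeleRing (𝓞 (Fp L)) (Fp L))]
      (μ : Measure (AdeleRing (𝓞 (Fp L)) (Fp L))) [μ.IsAddHaarMeasure]
      (nB : AdeleRing (𝓞 (Fp L)) (Fp L) → unipDelta L eB dB hdB dW hdW) (_ : Continuous nB) (_ : ∀ s t, nB (s + t) = nB s * nB t)
      (_ : ∀ t, (blk L eB dB hdB dW hdW (nB t : HA L eB dB hdB dW hdW)).toBlocks₁₂ =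
        Matrix.of fun _ _ => AdeleRing.baseChange (Fp L) L t * algebraMap L (AdeleRing (𝓞 L) L) (imagUnit L))
      (γ : Projectivization L (Fin 2 → L) → GL (Fin 2) L)
      (_ : ∀ p, Projectivization.mk L ((γ p : Matrix (Fin 2) (Fin 2) L) 1) (row_ne_zero (γ p) 1) = p),
      ∀ z : ℂ, 0 < z.re → ∃ C a a₂ c a' r : ℝ, 0 ≤ C ∧ 0 ≤ a ∧ 0 ≤ a₂ ∧ 0 < c ∧ 0 ≤ a' ∧ 0 < r ∧
        ∀ (S : skewMatrices ((IsCMField.complexConj L : L ≃ₐ[Fp L] L) : L →+* L) ((gramR L e dV hdV dW hdW).map (algebraMap (Fp L) L))) (u w : Fin 2 → L),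
          (S : Matrix (Fin 2) (Fin 2) L) = Matrix.vecMulVec u w → u ≠ 0 → ∀ (hw : w ≠ 0) (S' : Matrix (Fin 2) (Fin 2) L),
          (∀ v : HA L e dV hdV dW hdW, v ∈ unipDelta L e dV hdV dW hdW →
            unipDeltaChar L e dV hdV dW hdW (S : Matrix (Fin 2) (Fin 2) L) ((Λ (Matrix.GeneralLinearGroup.map (algebraMap L (AdeleRing (𝓞 L) L)) (γ (Projectivization.mk L w hw))))⁻¹ * v * Λ (Matrix.GeneralLinearGroup.map (algebraMap L (AdeleRing (𝓞 L) L)) (γ (Projectivization.mk L w hw)))) =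
              unipDeltaChar L e dV hdV dW hdW S' v) →
          ∀ D : ℕ, 1 ≤ D → (∀ i j, IsIntegral ℤ ((D : L) * (S : Matrix (Fin 2) (Fin 2) L) i j)) →
          ∀ s : ℂ, dist s z < r → ∀ h : HA L e dV hdV dW hdW,
            ‖whittakerDelta L eB dB hdB dW hdW (Measure.map nB μ)
                ((Matrix.reindex (idxSplit e eA eB) (idxSplit e eA eB) S').toBlocks₂₂)
                (fun y => f s (blkD L e eA eB dA hdA dB hdB dV hdV hVA hVB dW hdW (1, y) * (Λ (Matrix.GeneralLinearGroup.map (algebraMap L (AdeleRing (𝓞 L) L)) (γ (Projectivization.mk L w hw))) * h))) 1‖ ≤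
              C * adelicHeightGL (2 + 2) L (h : GL (Fin (2 + 2)) (AdeleRing (𝓞 L) L)) ^ a * (D : ℝ) ^ a₂ *
                (Real.exp (-(c * adelicHeightGL (2 + 2) L (h : GL (Fin (2 + 2)) (AdeleRing (𝓞 L) L)) ^ (-a') * ‖(fun i j => NumberField.mixedEmbedding L ((S : Matrix (Fin 2) (Fin 2) L) i j))‖)) * (1 + ‖(fun i j => NumberField.mixedEmbedding L ((S : Matrix (Fin 2) (Fin 2) L) i j))‖) ^ Nb)) ∧
    (e (1, 0) = 0 → ∀ {n₁ n₂ : ℕ} (eA : Fin 1 × Fin 1 ≃ Fin n₁) (eB : Fin 1 × Fin 1 ≃ Fin n₂)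
      (dA : Fin 1 → L) (hdA : ∀ i, IsCMField.complexConj L (dA i) = dA i)
      (dB : Fin 1 → L) (hdB : ∀ i, IsCMField.complexConj L (dB i) = dB i)
      (hVA : ∀ i, dV (Fin.castAdd 1 i) = dA i) (hVB : ∀ j, dV (Fin.natAdd 1 j) = dB j)
      [MeasurableSpace (unipDelta L eA dA hdA dW hdW)] [BorelSpace (unipDelta L eA dA hdA dW hdW)]
      (Λ : GL (Fin 2) (AdeleRing (𝓞 L) L) →* HA L e dV hdV dW hdW)
      (hΛ : ∀ g : GL (Fin 2) (AdeleRing (𝓞 L) L), blk L e dV hdV dW hdW (Λ g) =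
        cayR (AdeleRing (𝓞 L) L) (Fin 2) * Matrix.fromBlocks (g : Matrix (Fin 2) (Fin 2) (AdeleRing (𝓞 L) L)) 0 0
          (((gramR L e dV hdV dW hdW).map ((algebraMap L (AdeleRing (𝓞 L) L)).comp (algebraMap (Fp L) L)))⁻¹ *
            (((g⁻¹ : GL (Fin 2) (AdeleRing (𝓞 L) L)) : Matrix (Fin 2) (Fin 2) (AdeleRing (𝓞 L) L)).map
              (conjAdele (Fp L) L (IsCMField.complexConj L)))ᵀ *
            (gramR L e dV hdV dW hdW).map ((algebraMap L (AdeleRing (𝓞 L) L)).comp (algebraMap (Fp L) L))) *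
          cayRinv (AdeleRing (𝓞 L) L) (Fin 2))
      [MeasurableSpace (AdeleRing (𝓞 (Fp L)) (Fp L))] [BorelSpace (AdeleRing (𝓞 (Fp L)) (Fp L))]
      (μ : Measure (AdeleRing (𝓞 (Fp L)) (Fp L))) [μ.IsAddHaarMeasure]
      (nA : AdeleRing (𝓞 (Fp L)) (Fp L) → unipDelta L eA dA hdA dW hdW) (_ : Continuous nA) (_ : ∀ s t, nA (s + t) = nA s * nA t)
      (_ : ∀ t, (blk L eA dA hdA dW hdW (nA t : HA L eA dA hdA dW hdW)).toBlocks₁₂ =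
        Matrix.of fun _ _ => AdeleRing.baseChange (Fp L) L t * algebraMap L (AdeleRing (𝓞 L) L) (imagUnit L))
      (γ : Projectivization L (Fin 2 → L) → GL (Fin 2) L)
      (_ : ∀ p, Projectivization.mk L ((γ p : Matrix (Fin 2) (Fin 2) L) 1) (row_ne_zero (γ p) 1) = p),
      ∀ z : ℂ, 0 < z.re → ∃ C a a₂ c a' r : ℝ, 0 ≤ C ∧ 0 ≤ a ∧ 0 ≤ a₂ ∧ 0 < c ∧ 0 ≤ a' ∧ 0 < r ∧
        ∀ (S : skewMatrices ((IsCMField.complexConj L : L ≃ₐ[Fp L] L) : L →+* L) ((gramR L e dV hdV dW hdW).map (algebraMap (Fp L) L))) (u w : Fin 2 → L),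
          (S : Matrix (Fin 2) (Fin 2) L) = Matrix.vecMulVec u w → u ≠ 0 → ∀ (hw : w ≠ 0) (S' : Matrix (Fin 2) (Fin 2) L),
          (∀ v : HA L e dV hdV dW hdW, v ∈ unipDelta L e dV hdV dW hdW →
            unipDeltaChar L e dV hdV dW hdW (S : Matrix (Fin 2) (Fin 2) L) ((Λ (Matrix.GeneralLinearGroup.map (algebraMap L (AdeleRing (𝓞 L) L)) (γ (Projectivization.mk L w hw))))⁻¹ * v * Λ (Matrix.GeneralLinearGroup.map (algebraMap L (AdeleRing (𝓞 L) L)) (γ (Projectivization.mk L w hw)))) =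
              unipDeltaChar L e dV hdV dW hdW S' v) →
          ∀ D : ℕ, 1 ≤ D → (∀ i j, IsIntegral ℤ ((D : L) * (S : Matrix (Fin 2) (Fin 2) L) i j)) →
          ∀ s : ℂ, dist s z < r → ∀ h : HA L e dV hdV dW hdW,
            ‖whittakerDelta L eA dA hdA dW hdW (Measure.map nA μ)
                ((Matrix.reindex (idxSplit e eA eB) (idxSplit e eA eB) S').toBlocks₁₁)
                (fun y => f s (blkD L e eA eB dA hdA dB hdB dV hdV hVA hVB dW hdW (y, 1) * (Λ (Matrix.GeneralLinearGroup.map (algebraMap L (AdeleRing (𝓞 L) L)) (γ (Projectivization.mk L w hw))) * h))) 1‖ ≤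
              C * adelicHeightGL (2 + 2) L (h : GL (Fin (2 + 2)) (AdeleRing (𝓞 L) L)) ^ a * (D : ℝ) ^ a₂ *
                (Real.exp (-(c * adelicHeightGL (2 + 2) L (h : GL (Fin (2 + 2)) (AdeleRing (𝓞 L) L)) ^ (-a') * ‖(fun i j => NumberField.mixedEmbedding L ((S : Matrix (Fin 2) (Fin 2) L) i j))‖)) * (1 + ‖(fun i j => NumberField.mixedEmbedding L ((S : Matrix (Fin 2) (Fin 2) L) i j))‖) ^ Nb)) := by
  refine ⟨?_, fun h0 => (enum_absurd he h0).elim⟩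
  intro _ n₁ n₂ eA eB dA hdA dB hdB hVA hVB mB bB Λ hΛ mA bA μ hμ nB hnBc hnBadd hnB γ hγ z hz
  -- the two additive-Haar σ-algebras on `𝔸_{L⁺}` are both the Borel one
  have hm : mA = mA₀ := by rw [@BorelSpace.measurable_eq _ _ mA bA, @BorelSpace.measurable_eq _ _ mA₀ bA₀]
  subst hm
  -- the frame change `W(F) = c • W(F₀)` (★ (dec-0′)); the `d ≠ 0` letter of the letter's line follows from `dV ≠ 0`
  have hchange := exists_whittakerDelta_line_eq_smul_of_frames L e dV hdV hdV0 dW hdW hdW0 lam hlam hw 𝒦 h𝒦 f hstd hcont νN β hβ hβ0 hβtop hK hβK wq hwq he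
    eA₀ eB₀ dA₀ hdA₀ dB₀ hdB₀ hdB0₀ hVA₀ hVB₀ Λ₀ hΛ₀ μ₀ nB₀ hnBc₀ hnBadd₀ hnB₀ γ₀ hγ₀
    eA eB dA hdA dB hdB (fun i => by rw [← hVB i]; exact hdV0 _) hVA hVB Λ hΛ μ nB hnBc hnBadd hnB γ hγ
  obtain ⟨c₀, hc₀, hW⟩ := hchange
  obtain ⟨C, a, a₂, c, a', r, hC, ha, ha₂, hc, ha', hr, hb⟩ := hdecF₀ z hz
  have hz2 : 0 < z.re / 2 := by linarith
  refine ⟨c₀ * C, a, a₂, c, a', min r (z.re / 2), mul_nonneg hc₀.le hC, ha, ha₂, hc, ha', lt_min hr hz2,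
    fun S u w hS1 hu hw S' hψ D hD hint s hs h => ?_⟩
  have hs0 : 0 < s.re := lt_of_lt_of_le hz2 (half_re_le_re_of_dist_lt hs)
  -- a transported index at the fixed frame (★ `exists_levi_conj_index`)
  obtain ⟨S'₀, -, -, hψ₀⟩ := exists_levi_conj_index L e dV hdV dW hdW Λ₀ hΛ₀ hdV0 hdW0 (γ₀ (Projectivization.mk L w hw)) (S : Matrix (Fin 2) (Fin 2) L)
  rw [hW S hS1 hu hw S'₀ hψ₀ S' hψ hs0 h, norm_real_smul_of_pos hc₀]
  have hb' := hb S u w hS1 hu hw S'₀ hψ₀ D hD hint s (lt_of_lt_of_le hs (min_le_left _ _)) h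
  calc c₀ * _ ≤ c₀ * _ := mul_le_mul_of_nonneg_left hb' hc₀.le
    _ = _ := by ring

/-- **THE (P-dec) HEAD, `inl` ENUMERATION `e (1,0) = 0`** — the same from ONE `A`-line frame `F₀ = (eA₀ eB₀ dA₀ dB₀, Λ₀, μ₀, nA₀, γ₀)` and `hWdec0`'s inner block AT `F₀`.
[cite: KudlaRallis1994, §2 (2.10)–(2.12)] [cite: MoeglinWaldspurger1995, II.1.7, IV.1.9] [cite: Shimura1997, §18.4 Prop. 18.14] -/
theorem wdec_of_oneFrame_inl
    (L : Type) [Field L] [NumberField L] [IsCMField L] (e : Fin 2 × Fin 1 ≃ Fin 2)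
    (dV : Fin 2 → L) (hdV : ∀ i, IsCMField.complexConj L (dV i) = dV i) (hdV0 : ∀ i, dV i ≠ 0)
    (dW : Fin 1 → L) (hdW : ∀ i, IsCMField.complexConj L (dW i) = dW i) (hdW0 : ∀ i, dW i ≠ 0)
    (lam : IdeleClassGroup L →ₜ* Circle) (hlam : IsConjugateSymplectic L lam) (hw : HasWeight L lam 1)
    (𝒦 : IwasawaDatum L e dV hdV dW hdW) (h𝒦 : 𝒦.IsStd) (f : ℂ → HA L e dV hdV dW hdW → ℂ)
    (hstd : IsStandardSectionFamily 𝒦 (toHeckeCharacter L lam⁻¹) f) (hcont : ∀ s, Continuous (f s))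
    [MeasurableSpace (unipDelta L e dV hdV dW hdW)] [BorelSpace (unipDelta L e dV hdV dW hdW)]
    (νN : Measure (unipDelta L e dV hdV dW hdW)) [νN.IsHaarMeasure]
    (β : unipDelta L e dV hdV dW hdW → ℝ≥0∞) (hβ : IsCoveringWeight (unipDeltaRat L e dV hdV dW hdW) β)
    (hβ0 : ∫⁻ u, β u ∂νN ≠ 0) (hβtop : ∫⁻ u, β u ∂νN ≠ ∞)
    {K : Set (unipDelta L e dV hdV dW hdW)} (hK : IsCompact K) (hβK : ∀ u, β u ≤ K.indicator 1 u)
    (wq : unipDeltaRat L e dV hdV dW hdW → ratH L e dV hdV dW hdW)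
    (hwq : ∀ ν, ((wq ν : ratH L e dV hdV dW hdW) : HA L e dV hdV dW hdW) = weylDelta L e dV hdV dW hdW * ((ν : unipDelta L e dV hdV dW hdW) : HA L e dV hdV dW hdW))
    (he : e (1, 0) = 0)
    -- ONE frame `F₀` BY VALUE (★ p863230's frame bytes)
    -- the see-saw datum `V = A ⊕ B` BY VALUE
    {n₁₀ n₂₀ : ℕ} (eA₀ : Fin 1 × Fin 1 ≃ Fin n₁₀) (eB₀ : Fin 1 × Fin 1 ≃ Fin n₂₀)
    (dA₀ : Fin 1 → L) (hdA₀ : ∀ i, IsCMField.complexConj L (dA₀ i) = dA₀ i) (hdA0₀ : ∀ i, dA₀ i ≠ 0)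
    (dB₀ : Fin 1 → L) (hdB₀ : ∀ i, IsCMField.complexConj L (dB₀ i) = dB₀ i)
    (hVA₀ : ∀ i, dV (Fin.castAdd 1 i) = dA₀ i) (hVB₀ : ∀ j, dV (Fin.natAdd 1 j) = dB₀ j)
    [MeasurableSpace (unipDelta L eA₀ dA₀ hdA₀ dW hdW)] [BorelSpace (unipDelta L eA₀ dA₀ hdA₀ dW hdW)]
    -- the Levi chart BY VALUE (★ `exists_leviHom`)
    (Λ₀ : GL (Fin 2) (AdeleRing (𝓞 L) L) →* HA L e dV hdV dW hdW)
    (hΛ₀ : ∀ g : GL (Fin 2) (AdeleRing (𝓞 L) L), blk L e dV hdV dW hdW (Λ₀ g) =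
      cayR (AdeleRing (𝓞 L) L) (Fin 2) * Matrix.fromBlocks (g : Matrix (Fin 2) (Fin 2) (AdeleRing (𝓞 L) L)) 0 0
        (((gramR L e dV hdV dW hdW).map ((algebraMap L (AdeleRing (𝓞 L) L)).comp (algebraMap (Fp L) L)))⁻¹ *
          (((g⁻¹ : GL (Fin 2) (AdeleRing (𝓞 L) L)) : Matrix (Fin 2) (Fin 2) (AdeleRing (𝓞 L) L)).map
            (conjAdele (Fp L) L (IsCMField.complexConj L)))ᵀ *
          (gramR L e dV hdV dW hdW).map ((algebraMap L (AdeleRing (𝓞 L) L)).comp (algebraMap (Fp L) L))) *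
        cayRinv (AdeleRing (𝓞 L) L) (Fin 2))
    -- the additive Haar measure on `𝔸_{L⁺}` and the line chart of `H(A)` BY VALUE (★ p862662 `exists_lineChart` on the datum `eA₀ dA₀`)
    [mA₀ : MeasurableSpace (AdeleRing (𝓞 (Fp L)) (Fp L))] [bA₀ : BorelSpace (AdeleRing (𝓞 (Fp L)) (Fp L))]
    (μ₀ : Measure (AdeleRing (𝓞 (Fp L)) (Fp L))) [μ₀.IsAddHaarMeasure]
    (nA₀ : AdeleRing (𝓞 (Fp L)) (Fp L) → unipDelta L eA₀ dA₀ hdA₀ dW hdW) (hnAc₀ : Continuous nA₀) (hnAadd₀ : ∀ s t, nA₀ (s + t) = nA₀ s * nA₀ t)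
    (hnA₀ : ∀ t, (blk L eA₀ dA₀ hdA₀ dW hdW (nA₀ t : HA L eA₀ dA₀ hdA₀ dW hdW)).toBlocks₁₂ =
      Matrix.of fun _ _ => AdeleRing.baseChange (Fp L) L t * algebraMap L (AdeleRing (𝓞 L) L) (imagUnit L))
    -- the row section BY VALUE (★ `exists_rowSection`)
    (γ₀ : Projectivization L (Fin 2 → L) → GL (Fin 2) L)
    (hγ₀ : ∀ p, Projectivization.mk L ((γ₀ p : Matrix (Fin 2) (Fin 2) L) 1) (row_ne_zero (γ₀ p) 1) = p)
    -- the decay exponent and the ONE-FRAME decay letter (= ★ p863630's inner block AT `F₀`)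
    (Nb : ℕ)
    (hdecF₀ : ∀ z : ℂ, 0 < z.re → ∃ C a a₂ c a' r : ℝ, 0 ≤ C ∧ 0 ≤ a ∧ 0 ≤ a₂ ∧ 0 < c ∧ 0 ≤ a' ∧ 0 < r ∧
        ∀ (S : skewMatrices ((IsCMField.complexConj L : L ≃ₐ[Fp L] L) : L →+* L) ((gramR L e dV hdV dW hdW).map (algebraMap (Fp L) L))) (u w : Fin 2 → L),
          (S : Matrix (Fin 2) (Fin 2) L) = Matrix.vecMulVec u w → u ≠ 0 → ∀ (hw : w ≠ 0) (S' : Matrix (Fin 2) (Fin 2) L),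
          (∀ v : HA L e dV hdV dW hdW, v ∈ unipDelta L e dV hdV dW hdW →
            unipDeltaChar L e dV hdV dW hdW (S : Matrix (Fin 2) (Fin 2) L) ((Λ₀ (Matrix.GeneralLinearGroup.map (algebraMap L (AdeleRing (𝓞 L) L)) (γ₀ (Projectivization.mk L w hw))))⁻¹ * v * Λ₀ (Matrix.GeneralLinearGroup.map (algebraMap L (AdeleRing (𝓞 L) L)) (γ₀ (Projectivization.mk L w hw)))) =
              unipDeltaChar L e dV hdV dW hdW S' v) →
          ∀ D : ℕ, 1 ≤ D → (∀ i j, IsIntegral ℤ ((D : L) * (S : Matrix (Fin 2) (Fin 2) L) i j)) →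
          ∀ s : ℂ, dist s z < r → ∀ h : HA L e dV hdV dW hdW,
            ‖whittakerDelta L eA₀ dA₀ hdA₀ dW hdW (Measure.map nA₀ μ₀)
                ((Matrix.reindex (idxSplit e eA₀ eB₀) (idxSplit e eA₀ eB₀) S').toBlocks₁₁)
                (fun y => f s (blkD L e eA₀ eB₀ dA₀ hdA₀ dB₀ hdB₀ dV hdV hVA₀ hVB₀ dW hdW (y, 1) * (Λ₀ (Matrix.GeneralLinearGroup.map (algebraMap L (AdeleRing (𝓞 L) L)) (γ₀ (Projectivization.mk L w hw))) * h))) 1‖ ≤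
              C * adelicHeightGL (2 + 2) L (h : GL (Fin (2 + 2)) (AdeleRing (𝓞 L) L)) ^ a * (D : ℝ) ^ a₂ *
                (Real.exp (-(c * adelicHeightGL (2 + 2) L (h : GL (Fin (2 + 2)) (AdeleRing (𝓞 L) L)) ^ (-a') * ‖(fun i j => NumberField.mixedEmbedding L ((S : Matrix (Fin 2) (Fin 2) L) i j))‖)) * (1 + ‖(fun i j => NumberField.mixedEmbedding L ((S : Matrix (Fin 2) (Fin 2) L) i j))‖) ^ Nb)) :
    (e (1, 0) = 1 → ∀ {n₁ n₂ : ℕ} (eA : Fin 1 × Fin 1 ≃ Fin n₁) (eB : Fin 1 × Fin 1 ≃ Fin n₂)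
      (dA : Fin 1 → L) (hdA : ∀ i, IsCMField.complexConj L (dA i) = dA i)
      (dB : Fin 1 → L) (hdB : ∀ i, IsCMField.complexConj L (dB i) = dB i)
      (hVA : ∀ i, dV (Fin.castAdd 1 i) = dA i) (hVB : ∀ j, dV (Fin.natAdd 1 j) = dB j)
      [MeasurableSpace (unipDelta L eB dB hdB dW hdW)] [BorelSpace (unipDelta L eB dB hdB dW hdW)]
      (Λ : GL (Fin 2) (AdeleRing (𝓞 L) L) →* HA L e dV hdV dW hdW)
      (hΛ : ∀ g : GL (Fin 2) (AdeleRing (𝓞 L) L), blk L e dV hdV dW hdW (Λ g) =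
        cayR (AdeleRing (𝓞 L) L) (Fin 2) * Matrix.fromBlocks (g : Matrix (Fin 2) (Fin 2) (AdeleRing (𝓞 L) L)) 0 0
          (((gramR L e dV hdV dW hdW).map ((algebraMap L (AdeleRing (𝓞 L) L)).comp (algebraMap (Fp L) L)))⁻¹ *
            (((g⁻¹ : GL (Fin 2) (AdeleRing (𝓞 L) L)) : Matrix (Fin 2) (Fin 2) (AdeleRing (𝓞 L) L)).map
              (conjAdele (Fp L) L (IsCMField.complexConj L)))ᵀ *
            (gramR L e dV hdV dW hdW).map ((algebraMap L (AdeleRing (𝓞 L) L)).comp (algebraMap (Fp L) L))) *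
          cayRinv (AdeleRing (𝓞 L) L) (Fin 2))
      [MeasurableSpace (AdeleRing (𝓞 (Fp L)) (Fp L))] [BorelSpace (AdeleRing (𝓞 (Fp L)) (Fp L))]
      (μ : Measure (AdeleRing (𝓞 (Fp L)) (Fp L))) [μ.IsAddHaarMeasure]
      (nB : AdeleRing (𝓞 (Fp L)) (Fp L) → unipDelta L eB dB hdB dW hdW) (_ : Continuous nB) (_ : ∀ s t, nB (s + t) = nB s * nB t)
      (_ : ∀ t, (blk L eB dB hdB dW hdW (nB t : HA L eB dB hdB dW hdW)).toBlocks₁₂ =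
        Matrix.of fun _ _ => AdeleRing.baseChange (Fp L) L t * algebraMap L (AdeleRing (𝓞 L) L) (imagUnit L))
      (γ : Projectivization L (Fin 2 → L) → GL (Fin 2) L)
      (_ : ∀ p, Projectivization.mk L ((γ p : Matrix (Fin 2) (Fin 2) L) 1) (row_ne_zero (γ p) 1) = p),
      ∀ z : ℂ, 0 < z.re → ∃ C a a₂ c a' r : ℝ, 0 ≤ C ∧ 0 ≤ a ∧ 0 ≤ a₂ ∧ 0 < c ∧ 0 ≤ a' ∧ 0 < r ∧
        ∀ (S : skewMatrices ((IsCMField.complexConj L : L ≃ₐ[Fp L] L) : L →+* L) ((gramR L e dV hdV dW hdW).map (algebraMap (Fp L) L))) (u w : Fin 2 → L),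
          (S : Matrix (Fin 2) (Fin 2) L) = Matrix.vecMulVec u w → u ≠ 0 → ∀ (hw : w ≠ 0) (S' : Matrix (Fin 2) (Fin 2) L),
          (∀ v : HA L e dV hdV dW hdW, v ∈ unipDelta L e dV hdV dW hdW →
            unipDeltaChar L e dV hdV dW hdW (S : Matrix (Fin 2) (Fin 2) L) ((Λ (Matrix.GeneralLinearGroup.map (algebraMap L (AdeleRing (𝓞 L) L)) (γ (Projectivization.mk L w hw))))⁻¹ * v * Λ (Matrix.GeneralLinearGroup.map (algebraMap L (AdeleRing (𝓞 L) L)) (γ (Projectivization.mk L w hw)))) =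
              unipDeltaChar L e dV hdV dW hdW S' v) →
          ∀ D : ℕ, 1 ≤ D → (∀ i j, IsIntegral ℤ ((D : L) * (S : Matrix (Fin 2) (Fin 2) L) i j)) →
          ∀ s : ℂ, dist s z < r → ∀ h : HA L e dV hdV dW hdW,
            ‖whittakerDelta L eB dB hdB dW hdW (Measure.map nB μ)
                ((Matrix.reindex (idxSplit e eA eB) (idxSplit e eA eB) S').toBlocks₂₂)
                (fun y => f s (blkD L e eA eB dA hdA dB hdB dV hdV hVA hVB dW hdW (1, y) * (Λ (Matrix.GeneralLinearGroup.map (algebraMap L (AdeleRing (𝓞 L) L)) (γ (Projectivization.mk L w hw))) * h))) 1‖ ≤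
              C * adelicHeightGL (2 + 2) L (h : GL (Fin (2 + 2)) (AdeleRing (𝓞 L) L)) ^ a * (D : ℝ) ^ a₂ *
                (Real.exp (-(c * adelicHeightGL (2 + 2) L (h : GL (Fin (2 + 2)) (AdeleRing (𝓞 L) L)) ^ (-a') * ‖(fun i j => NumberField.mixedEmbedding L ((S : Matrix (Fin 2) (Fin 2) L) i j))‖)) * (1 + ‖(fun i j => NumberField.mixedEmbedding L ((S : Matrix (Fin 2) (Fin 2) L) i j))‖) ^ Nb)) ∧
    (e (1, 0) = 0 → ∀ {n₁ n₂ : ℕ} (eA : Fin 1 × Fin 1 ≃ Fin n₁) (eB : Fin 1 × Fin 1 ≃ Fin n₂)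
      (dA : Fin 1 → L) (hdA : ∀ i, IsCMField.complexConj L (dA i) = dA i)
      (dB : Fin 1 → L) (hdB : ∀ i, IsCMField.complexConj L (dB i) = dB i)
      (hVA : ∀ i, dV (Fin.castAdd 1 i) = dA i) (hVB : ∀ j, dV (Fin.natAdd 1 j) = dB j)
      [MeasurableSpace (unipDelta L eA dA hdA dW hdW)] [BorelSpace (unipDelta L eA dA hdA dW hdW)]
      (Λ : GL (Fin 2) (AdeleRing (𝓞 L) L) →* HA L e dV hdV dW hdW)
      (hΛ : ∀ g : GL (Fin 2) (AdeleRing (𝓞 L) L), blk L e dV hdV dW hdW (Λ g) =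
        cayR (AdeleRing (𝓞 L) L) (Fin 2) * Matrix.fromBlocks (g : Matrix (Fin 2) (Fin 2) (AdeleRing (𝓞 L) L)) 0 0
          (((gramR L e dV hdV dW hdW).map ((algebraMap L (AdeleRing (𝓞 L) L)).comp (algebraMap (Fp L) L)))⁻¹ *
            (((g⁻¹ : GL (Fin 2) (AdeleRing (𝓞 L) L)) : Matrix (Fin 2) (Fin 2) (AdeleRing (𝓞 L) L)).map
              (conjAdele (Fp L) L (IsCMField.complexConj L)))ᵀ *
            (gramR L e dV hdV dW hdW).map ((algebraMap L (AdeleRing (𝓞 L) L)).comp (algebraMap (Fp L) L))) *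
          cayRinv (AdeleRing (𝓞 L) L) (Fin 2))
      [MeasurableSpace (AdeleRing (𝓞 (Fp L)) (Fp L))] [BorelSpace (AdeleRing (𝓞 (Fp L)) (Fp L))]
      (μ : Measure (AdeleRing (𝓞 (Fp L)) (Fp L))) [μ.IsAddHaarMeasure]
      (nA : AdeleRing (𝓞 (Fp L)) (Fp L) → unipDelta L eA dA hdA dW hdW) (_ : Continuous nA) (_ : ∀ s t, nA (s + t) = nA s * nA t)
      (_ : ∀ t, (blk L eA dA hdA dW hdW (nA t : HA L eA dA hdA dW hdW)).toBlocks₁₂ =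
        Matrix.of fun _ _ => AdeleRing.baseChange (Fp L) L t * algebraMap L (AdeleRing (𝓞 L) L) (imagUnit L))
      (γ : Projectivization L (Fin 2 → L) → GL (Fin 2) L)
      (_ : ∀ p, Projectivization.mk L ((γ p : Matrix (Fin 2) (Fin 2) L) 1) (row_ne_zero (γ p) 1) = p),
      ∀ z : ℂ, 0 < z.re → ∃ C a a₂ c a' r : ℝ, 0 ≤ C ∧ 0 ≤ a ∧ 0 ≤ a₂ ∧ 0 < c ∧ 0 ≤ a' ∧ 0 < r ∧
        ∀ (S : skewMatrices ((IsCMField.complexConj L : L ≃ₐ[Fp L] L) : L →+* L) ((gramR L e dV hdV dW hdW).map (algebraMap (Fp L) L))) (u w : Fin 2 → L),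
          (S : Matrix (Fin 2) (Fin 2) L) = Matrix.vecMulVec u w → u ≠ 0 → ∀ (hw : w ≠ 0) (S' : Matrix (Fin 2) (Fin 2) L),
          (∀ v : HA L e dV hdV dW hdW, v ∈ unipDelta L e dV hdV dW hdW →
            unipDeltaChar L e dV hdV dW hdW (S : Matrix (Fin 2) (Fin 2) L) ((Λ (Matrix.GeneralLinearGroup.map (algebraMap L (AdeleRing (𝓞 L) L)) (γ (Projectivization.mk L w hw))))⁻¹ * v * Λ (Matrix.GeneralLinearGroup.map (algebraMap L (AdeleRing (𝓞 L) L)) (γ (Projectivization.mk L w hw)))) =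
              unipDeltaChar L e dV hdV dW hdW S' v) →
          ∀ D : ℕ, 1 ≤ D → (∀ i j, IsIntegral ℤ ((D : L) * (S : Matrix (Fin 2) (Fin 2) L) i j)) →
          ∀ s : ℂ, dist s z < r → ∀ h : HA L e dV hdV dW hdW,
            ‖whittakerDelta L eA dA hdA dW hdW (Measure.map nA μ)
                ((Matrix.reindex (idxSplit e eA eB) (idxSplit e eA eB) S').toBlocks₁₁)
                (fun y => f s (blkD L e eA eB dA hdA dB hdB dV hdV hVA hVB dW hdW (y, 1) * (Λ (Matrix.GeneralLinearGroup.map (algebraMap L (AdeleRing (𝓞 L) L)) (γ (Projectivization.mk L w hw))) * h))) 1‖ ≤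
              C * adelicHeightGL (2 + 2) L (h : GL (Fin (2 + 2)) (AdeleRing (𝓞 L) L)) ^ a * (D : ℝ) ^ a₂ *
                (Real.exp (-(c * adelicHeightGL (2 + 2) L (h : GL (Fin (2 + 2)) (AdeleRing (𝓞 L) L)) ^ (-a') * ‖(fun i j => NumberField.mixedEmbedding L ((S : Matrix (Fin 2) (Fin 2) L) i j))‖)) * (1 + ‖(fun i j => NumberField.mixedEmbedding L ((S : Matrix (Fin 2) (Fin 2) L) i j))‖) ^ Nb)) := by
  refine ⟨fun h1 => (enum_absurd h1 he).elim, ?_⟩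
  intro _ n₁ n₂ eA eB dA hdA dB hdB hVA hVB mB bB Λ hΛ mA bA μ hμ nA hnAc hnAadd hnA γ hγ z hz
  -- the two additive-Haar σ-algebras on `𝔸_{L⁺}` are both the Borel one
  have hm : mA = mA₀ := by rw [@BorelSpace.measurable_eq _ _ mA bA, @BorelSpace.measurable_eq _ _ mA₀ bA₀]
  subst hm
  -- the frame change `W(F) = c • W(F₀)` (★ (dec-0′)); the `d ≠ 0` letter of the letter's line follows from `dV ≠ 0`
  have hchange := exists_whittakerDelta_line_eq_smul_of_frames_inl L e dV hdV hdV0 dW hdW hdW0 lam hlam hw 𝒦 h𝒦 f hstd hcont νN β hβ hβ0 hβtop hK hβK wq hwq he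
    eA₀ eB₀ dA₀ hdA₀ dB₀ hdB₀ hdA0₀ hVA₀ hVB₀ Λ₀ hΛ₀ μ₀ nA₀ hnAc₀ hnAadd₀ hnA₀ γ₀ hγ₀
    eA eB dA hdA dB hdB (fun i => by rw [← hVA i]; exact hdV0 _) hVA hVB Λ hΛ μ nA hnAc hnAadd hnA γ hγ
  obtain ⟨c₀, hc₀, hW⟩ := hchange
  obtain ⟨C, a, a₂, c, a', r, hC, ha, ha₂, hc, ha', hr, hb⟩ := hdecF₀ z hz
  have hz2 : 0 < z.re / 2 := by linarith
  refine ⟨c₀ * C, a, a₂, c, a', min r (z.re / 2), mul_nonneg hc₀.le hC, ha, ha₂, hc, ha', lt_min hr hz2,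
    fun S u w hS1 hu hw S' hψ D hD hint s hs h => ?_⟩
  have hs0 : 0 < s.re := lt_of_lt_of_le hz2 (half_re_le_re_of_dist_lt hs)
  -- a transported index at the fixed frame (★ `exists_levi_conj_index`)
  obtain ⟨S'₀, -, -, hψ₀⟩ := exists_levi_conj_index L e dV hdV dW hdW Λ₀ hΛ₀ hdV0 hdW0 (γ₀ (Projectivization.mk L w hw)) (S : Matrix (Fin 2) (Fin 2) L)
  rw [hW S hS1 hu hw S'₀ hψ₀ S' hψ hs0 h, norm_real_smul_of_pos hc₀]
  have hb' := hb S u w hS1 hu hw S'₀ hψ₀ D hD hint s (lt_of_lt_of_le hs (min_le_left _ _)) h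
  calc c₀ * _ ≤ c₀ * _ := mul_le_mul_of_nonneg_left hb' hc₀.le
    _ = _ := by ring

end Summit.HodgeConjecture.HodgeConjecture.Cruxes.HLiu418.K2LiuKindOneLineDecay

end
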